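import Mathlib.Data.Matrix.Mul
import Mathlib.Algebra.Order.BigOperators.Group.Finset
import Mathlib.Algebra.BigOperators.Ring.Finset
import Mathlib.Algebra.BigOperators.Field
import Mathlib.Algebra.Order.Field.Basic
import Mathlib.Tactic.FieldSimp
import Mathlib.Tactic.Linarith
import Mathlib.Tactic.Positivity
import HarnessLib

/-!
# Ventures/CertifiedQuantumChemistry — Rows/CholeskyResidualBound.lean: the integer-Cholesky-residual LOWER
# bound on the least eigenvalue of a symmetric matrix (the THEOREM of FORMAT-qcchol0 §4–§5 behind the
# `qc-lower-chol-v0` certificates)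

HONEST FRAMING (verbatim): certified bounds for a stated model Hamiltonian in a stated basis; not a
claim about the real molecule beyond that model.

var-2 (gen 7), zero compute, PROVED glue only (0 sorry, no definition, no claim node; nothing here asserts
a bound about any model). A `qc-lower-chol-v0` certificate (var-1, `FORMAT-qcchol0-v0.md`) bounds the least
eigenvalue of a sector block `H` of the determinant-basis matrix of a pinned model from below in three
steps, each of which is an inequality between quadratic forms `v ⬝ᵥ (A *ᵥ v)`:

* §5.5 (Gram part + residual). If `c • (H' − μ • 1) = M * Mᵀ + T` with `0 < c` and every row sum and every
  column sum of `|T|` is at most `τ`, then `(μ − τ / c) · (v ⬝ᵥ v) ≤ v ⬝ᵥ (H' *ᵥ v)` for every `v`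
  (`M * Mᵀ` is a Gram matrix, so its form is a sum of squares; the form of `T` is at most `τ ‖v‖²` by the
  weighted AM–GM inequality `2|a||b| ≤ a² + b²` — the elementary proof of `‖T‖₂ ≤ ‖T‖_∞` for a matrix whose
  row and column absolute sums are `≤ τ`, in particular a symmetric one). In the certificates
  `c = 2^(2s)`, `μ = m_g / 2^t`, `H' = A2_g / 2^(t+1)` and `τ = τ_g`: theorem
  `le_dotProduct_mulVec_of_cholesky_residual`.
* §4 (rounding slop). If every row sum and column sum of `|H − H'|` is at most `ε` then
  `v ⬝ᵥ (H' *ᵥ v) − ε · (v ⬝ᵥ v) ≤ v ⬝ᵥ (H *ᵥ v)`: theorem `dotProduct_mulVec_sub_le_of_abs_sub_sum_le`;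
  combined END form `(μ − τ / c − ε) · (v ⬝ᵥ v) ≤ v ⬝ᵥ (H *ᵥ v)`: theorem
  `le_dotProduct_mulVec_of_cholesky_residual_rounded`.
* §3.3 / §5.5 (blocks). If `H` is block diagonal for a labelling `lab` and on every block the form is
  bounded below by `lo · ‖·‖²`, then so is the whole form: theorem
  `le_dotProduct_mulVec_of_blockDiagonal` (take `lo = min_g E_L,g`).

Everything is stated over an arbitrary linearly ordered field (the certificates live in `ℚ`), for square
matrices over a finite index type, with the witness `M` rectangular. The per-instance facts (the integers
`A2_g`, `m_g`, `M_g`, `τ_g`, the Slater–Condon identity `H = sector block of H_F`, admissibility) are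
established outside the kernel by the cell's readers (lineage A = var-1, lineage B = var-2's `qcchol_b`),
exactly as for every other certificate class. Reference: FORMAT-qcchol0-v0 §4–§5 (var-1, 2026-08-22);
the norm inequality is Higham, ASNA (2002) §6.3 / Gershgorin-type row-sum bounds.
-/

namespace Summit.Ventures.CertifiedQuantumChemistry

open Matrix Finset

variable {R : Type*} [Field R] [LinearOrder R] [IsStrictOrderedRing R]
variable {n m : Type*} [Fintype n] [Fintype m]

omit [LinearOrder R] [IsStrictOrderedRing R] in
/-- The quadratic form of a Gram matrix `M * Mᵀ` is a sum of squares: `v ⬝ᵥ ((M * Mᵀ) *ᵥ v) = ‖Mᵀ v‖²`. -/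
theorem dotProduct_gram_mulVec_eq (M : Matrix n m R) (v : n → R) :
    v ⬝ᵥ ((M * Mᵀ) *ᵥ v) = (Mᵀ *ᵥ v) ⬝ᵥ (Mᵀ *ᵥ v) := by
  rw [← mulVec_mulVec, dotProduct_mulVec, mulVec_transpose]

/-- The quadratic form of a Gram matrix `M * Mᵀ` is non-negative (`M Mᵀ ⪰ 0`, FORMAT-qcchol0 §5.5). -/
theorem dotProduct_gram_mulVec_nonneg (M : Matrix n m R) (v : n → R) :
    0 ≤ v ⬝ᵥ ((M * Mᵀ) *ᵥ v) := by
  rw [dotProduct_gram_mulVec_eq]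
  exact Finset.sum_nonneg fun i _ => mul_self_nonneg _

/-- **Row/column-sum bound on a quadratic form** (the elementary `‖T‖₂ ≤ ‖T‖_∞` for matrices whose row AND
column absolute sums are at most `τ`, e.g. symmetric ones): `|v ⬝ᵥ (T *ᵥ v)| ≤ τ · (v ⬝ᵥ v)`. -/
theorem abs_dotProduct_mulVec_le_of_abs_sum_le (T : Matrix n n R) (τ : R)
    (hrow : ∀ i, ∑ j, |T i j| ≤ τ) (hcol : ∀ j, ∑ i, |T i j| ≤ τ) (v : n → R) :
    |v ⬝ᵥ (T *ᵥ v)| ≤ τ * (v ⬝ᵥ v) := by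
  -- expand the form as a double sum
  have hform : v ⬝ᵥ (T *ᵥ v) = ∑ i, ∑ j, v i * T i j * v j := by
    simp only [dotProduct, mulVec, Finset.mul_sum, mul_assoc]
  rw [hform]
  -- termwise AM-GM: |v i * T i j * v j| ≤ |T i j| * (v i ^ 2 + v j ^ 2) / 2
  have hterm : ∀ i j, |v i * T i j * v j| ≤ |T i j| * (v i * v i) / 2 + |T i j| * (v j * v j) / 2 := by
    intro i j
    rw [abs_mul, abs_mul]
    have h2 : 2 * |v i| * |v j| ≤ v i * v i + v j * v j := by
      have := two_mul_le_add_sq (|v i|) (|v j|)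
      simpa [sq, abs_mul_abs_self] using this
    have hT : 0 ≤ |T i j| := abs_nonneg _
    nlinarith
  have h1 : ∑ i, (v i * v i) * (∑ j, |T i j|) ≤ ∑ i, (v i * v i) * τ :=
    sum_le_sum fun i _ => mul_le_mul_of_nonneg_left (hrow i) (mul_self_nonneg _)
  have h2 : ∑ j, (v j * v j) * (∑ i, |T i j|) ≤ ∑ j, (v j * v j) * τ :=
    sum_le_sum fun j _ => mul_le_mul_of_nonneg_left (hcol j) (mul_self_nonneg _)
  have hsq : ∑ i, (v i * v i) * τ = τ * (v ⬝ᵥ v) := by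
    rw [dotProduct, ← Finset.sum_mul]; ring
  calc |∑ i, ∑ j, v i * T i j * v j|
      ≤ ∑ i, |∑ j, v i * T i j * v j| := abs_sum_le_sum_abs _ _
    _ ≤ ∑ i, ∑ j, |v i * T i j * v j| := sum_le_sum fun i _ => abs_sum_le_sum_abs _ _
    _ ≤ ∑ i, ∑ j, (|T i j| * (v i * v i) / 2 + |T i j| * (v j * v j) / 2) :=
        sum_le_sum fun i _ => sum_le_sum fun j _ => hterm i j
    _ = (∑ i, ∑ j, |T i j| * (v i * v i) / 2) + ∑ i, ∑ j, |T i j| * (v j * v j) / 2 := by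
        simp only [Finset.sum_add_distrib]
    _ = (∑ i, (v i * v i) * (∑ j, |T i j|)) / 2 + (∑ j, (v j * v j) * (∑ i, |T i j|)) / 2 := by
        congr 1
        · rw [Finset.sum_div]
          refine sum_congr rfl fun i _ => ?_
          rw [Finset.mul_sum, Finset.sum_div]
          refine sum_congr rfl fun j _ => ?_
          ring
        · rw [Finset.sum_comm, Finset.sum_div]
          refine sum_congr rfl fun j _ => ?_
          rw [Finset.mul_sum, Finset.sum_div]
          refine sum_congr rfl fun i _ => ?_
          ring
    _ ≤ (∑ i, (v i * v i) * τ) / 2 + (∑ j, (v j * v j) * τ) / 2 := by linarith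
    _ = τ * (v ⬝ᵥ v) := by rw [hsq]; ring

/-- **The Cholesky-residual lower bound (FORMAT-qcchol0 §5.5).** If `c • (H − μ • 1) = M * Mᵀ + T` with
`0 < c`, and every row sum and column sum of `|T|` is at most `τ`, then the quadratic form of `H` is bounded
below by `(μ − τ / c) ‖v‖²`; in particular every eigenvalue of `H` is `≥ μ − τ / c`. In the certificates
`H = H'_g = A2_g / 2^(t+1)`, `μ = m_g / 2^t`, `c = 2^(2s)`, `τ = τ_g` (so `μ − τ / c = E'_L,g`). The witness
`M` may be rectangular and need not be triangular; nothing about how `μ`, `M` were found is used. -/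
theorem le_dotProduct_mulVec_of_cholesky_residual [DecidableEq n] (H T : Matrix n n R) (M : Matrix n m R)
    (c μ τ : R) (hc : 0 < c) (hfac : c • (H - μ • (1 : Matrix n n R)) = M * Mᵀ + T)
    (hrow : ∀ i, ∑ j, |T i j| ≤ τ) (hcol : ∀ j, ∑ i, |T i j| ≤ τ) (v : n → R) :
    (μ - τ / c) * (v ⬝ᵥ v) ≤ v ⬝ᵥ (H *ᵥ v) := by
  -- the form of the left-hand side of the factorisation
  have hlhs : v ⬝ᵥ ((c • (H - μ • (1 : Matrix n n R))) *ᵥ v) = c * (v ⬝ᵥ (H *ᵥ v)) - c * μ * (v ⬝ᵥ v) := by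
    rw [smul_mulVec, dotProduct_smul, sub_mulVec, smul_mulVec, one_mulVec, dotProduct_sub,
      dotProduct_smul, smul_eq_mul, smul_eq_mul]
    ring
  have hrhs : v ⬝ᵥ ((M * Mᵀ + T) *ᵥ v) = v ⬝ᵥ ((M * Mᵀ) *ᵥ v) + v ⬝ᵥ (T *ᵥ v) := by
    rw [add_mulVec, dotProduct_add]
  have hgram := dotProduct_gram_mulVec_nonneg M v
  have hT := (abs_le.mp (abs_dotProduct_mulVec_le_of_abs_sum_le T τ hrow hcol v)).1
  have key : c * (v ⬝ᵥ (H *ᵥ v)) - c * μ * (v ⬝ᵥ v) ≥ -(τ * (v ⬝ᵥ v)) := by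
    rw [← hlhs, hfac, hrhs]; linarith
  have hvv : 0 ≤ v ⬝ᵥ v := Finset.sum_nonneg fun i _ => mul_self_nonneg _
  rw [sub_mul, div_mul_eq_mul_div, sub_le_iff_le_add]
  have : τ * (v ⬝ᵥ v) / c ≥ μ * (v ⬝ᵥ v) - v ⬝ᵥ (H *ᵥ v) := by
    rw [ge_iff_le, le_div_iff₀ hc]
    nlinarith
  linarith

/-- **Rounding slop (FORMAT-qcchol0 §4 LEMMA).** If every row sum and column sum of `|H − H'|` is at most
`ε` (in the certificates: `ε = R / 2^(t+1)`, `R` = the per-row Slater–Condon term count, each term moved by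
at most `2^-(t+1)` under rounding to the dyadic grid), then `v ⬝ᵥ (H' *ᵥ v) − ε ‖v‖² ≤ v ⬝ᵥ (H *ᵥ v)`. -/
theorem dotProduct_mulVec_sub_le_of_abs_sub_sum_le (H H' : Matrix n n R) (ε : R)
    (hrow : ∀ i, ∑ j, |H i j - H' i j| ≤ ε) (hcol : ∀ j, ∑ i, |H i j - H' i j| ≤ ε) (v : n → R) :
    v ⬝ᵥ (H' *ᵥ v) - ε * (v ⬝ᵥ v) ≤ v ⬝ᵥ (H *ᵥ v) := by
  have h := (abs_le.mp (abs_dotProduct_mulVec_le_of_abs_sum_le (H - H') ε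
    (fun i => by simpa using hrow i) (fun j => by simpa using hcol j) v)).1
  have hsplit : v ⬝ᵥ ((H - H') *ᵥ v) = v ⬝ᵥ (H *ᵥ v) - v ⬝ᵥ (H' *ᵥ v) := by
    rw [sub_mulVec, dotProduct_sub]
  linarith

/-- **END form for one block (FORMAT-qcchol0 §5.5 with §4).** Exact factorisation data for the ROUNDED
matrix `H'` (`c • (H' − μ • 1) = M * Mᵀ + T`, row/column sums of `|T|` at most `τ`, `0 < c`) and the
rounding slop (`|H − H'|` row/column sums at most `ε`) give
`(μ − τ / c − ε) ‖v‖² ≤ v ⬝ᵥ (H *ᵥ v)`, i.e. `λ_min(H) ≥ m_g/2^t − τ_g/2^(2s) − ε = E_L,g`. -/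
theorem le_dotProduct_mulVec_of_cholesky_residual_rounded [DecidableEq n] (H H' T : Matrix n n R)
    (M : Matrix n m R) (c μ τ ε : R) (hc : 0 < c)
    (hfac : c • (H' - μ • (1 : Matrix n n R)) = M * Mᵀ + T)
    (hTrow : ∀ i, ∑ j, |T i j| ≤ τ) (hTcol : ∀ j, ∑ i, |T i j| ≤ τ)
    (hErow : ∀ i, ∑ j, |H i j - H' i j| ≤ ε) (hEcol : ∀ j, ∑ i, |H i j - H' i j| ≤ ε) (v : n → R) :
    (μ - τ / c - ε) * (v ⬝ᵥ v) ≤ v ⬝ᵥ (H *ᵥ v) := by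
  have h1 := le_dotProduct_mulVec_of_cholesky_residual H' T M c μ τ hc hfac hTrow hTcol v
  have h2 := dotProduct_mulVec_sub_le_of_abs_sub_sum_le H H' ε hErow hEcol v
  linarith [sub_mul (μ - τ / c) ε (v ⬝ᵥ v)]

omit [IsStrictOrderedRing R] in
/-- For a symmetric matrix the column-sum hypothesis is the row-sum hypothesis (the certificates' `T_g`
and `H − H'` are symmetric, and `τ_g := max_i Σ_j |T_g,ij|`). -/
theorem abs_col_sum_le_of_symm (T : Matrix n n R) (τ : R) (hT : ∀ i j, T i j = T j i)
    (hrow : ∀ i, ∑ j, |T i j| ≤ τ) (j : n) : ∑ i, |T i j| ≤ τ := by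
  simpa [hT _ j] using hrow j

/-- **Blocks (FORMAT-qcchol0 §3.3 LEMMA + §5.5 `min_g`).** If `H` is block diagonal with respect to a
labelling `lab : n → G` (entries between different labels vanish — exact D2h admissibility of the rounded
tables gives this for the determinant labels) and on every block the quadratic form is bounded below by
`lo ‖·‖²` (take `lo = min_g E_L,g`), then `lo ‖v‖² ≤ v ⬝ᵥ (H *ᵥ v)` on the whole space. -/
theorem le_dotProduct_mulVec_of_blockDiagonal {G : Type*} [Fintype G] [DecidableEq G]
    (H : Matrix n n R) (lab : n → G) (lo : R)
    (hblock : ∀ i j, lab i ≠ lab j → H i j = 0)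
    (hlo : ∀ g (w : {i // lab i = g} → R),
      lo * (w ⬝ᵥ w) ≤ w ⬝ᵥ ((H.submatrix Subtype.val Subtype.val) *ᵥ w))
    (v : n → R) : lo * (v ⬝ᵥ v) ≤ v ⬝ᵥ (H *ᵥ v) := by
  classical
  -- split both sides along the fibres of `lab`
  have hvv : v ⬝ᵥ v = ∑ g, ∑ i : {i // lab i = g}, v i.1 * v i.1 := by
    rw [dotProduct, ← Fintype.sum_fiberwise lab (fun i => v i * v i)]
  have hform : v ⬝ᵥ (H *ᵥ v) = ∑ g, ∑ i : {i // lab i = g}, v i.1 * ∑ j, H i.1 j * v j := by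
    rw [dotProduct, ← Fintype.sum_fiberwise lab (fun i => v i * (H *ᵥ v) i)]
    rfl
  -- inside the fibre of `g`, only the columns of the same fibre contribute
  have hinner : ∀ g (i : {i // lab i = g}),
      ∑ j, H i.1 j * v j = ∑ j : {j // lab j = g}, H i.1 j.1 * v j.1 := by
    intro g i
    rw [← Fintype.sum_fiberwise lab (fun j => H i.1 j * v j)]
    rw [Finset.sum_eq_single g]
    · intro g' _ hg'
      refine Finset.sum_eq_zero fun j _ => ?_
      have hne : lab i.1 ≠ lab j.1 := by rw [i.2, j.2]; exact fun h => hg' h.symm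
      rw [hblock i.1 j.1 hne, zero_mul]
    · intro h; exact absurd (Finset.mem_univ g) h
  rw [hvv, hform, Finset.mul_sum]
  refine sum_le_sum fun g _ => ?_
  have hw := hlo g (fun i => v i.1)
  have hL : (fun i : {i // lab i = g} => v i.1) ⬝ᵥ (fun i : {i // lab i = g} => v i.1)
      = ∑ i : {i // lab i = g}, v i.1 * v i.1 := rfl
  have hR : (fun i : {i // lab i = g} => v i.1) ⬝ᵥ
        ((H.submatrix Subtype.val Subtype.val) *ᵥ fun i : {i // lab i = g} => v i.1)
      = ∑ i : {i // lab i = g}, v i.1 * ∑ j : {j // lab j = g}, H i.1 j.1 * v j.1 := by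
    simp only [dotProduct, mulVec, submatrix_apply]
  rw [hL, hR] at hw
  calc lo * ∑ i : {i // lab i = g}, v i.1 * v i.1
      ≤ ∑ i : {i // lab i = g}, v i.1 * ∑ j : {j // lab j = g}, H i.1 j.1 * v j.1 := hw
    _ = ∑ i : {i // lab i = g}, v i.1 * ∑ j, H i.1 j * v j := by
        refine sum_congr rfl fun i _ => ?_
        rw [hinner g i]

/-- **The certificate's integer form (FORMAT-qcchol0 §5.1–§5.5).** With `A2 = 2^(t+1) • H'` (the integer
matrix of the rounded block), `μ = m / 2^t`, `t + 1 ≤ 2s`, and the printed residual identity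
`2^(2s−t−1) • (A2 − 2m • 1) = M Mᵀ + T` (i.e. `T := 2^(2s−t−1)(A2 − 2m I) − M Mᵀ`) with row/column sums of
`|T|` at most `τ`, the bound reads `(m / 2^t − τ / 2^(2s)) ‖v‖² ≤ v ⬝ᵥ (H' *ᵥ v)` (`= E'_L,g ‖v‖²`). -/
theorem le_dotProduct_mulVec_of_integer_residual [DecidableEq n] (H' A2 T : Matrix n n R)
    (M : Matrix n m R) (mI τ : R) (s t : ℕ) (hst : t + 1 ≤ 2 * s) (hA2 : (2 : R) ^ (t + 1) • H' = A2)
    (hfac : (2 : R) ^ (2 * s - (t + 1)) • (A2 - (2 * mI) • (1 : Matrix n n R)) = M * Mᵀ + T)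
    (hrow : ∀ i, ∑ j, |T i j| ≤ τ) (hcol : ∀ j, ∑ i, |T i j| ≤ τ) (v : n → R) :
    (mI / 2 ^ t - τ / 2 ^ (2 * s)) * (v ⬝ᵥ v) ≤ v ⬝ᵥ (H' *ᵥ v) := by
  have h2s : (2 : R) ^ (2 * s) = (2 : R) ^ (2 * s - (t + 1)) * (2 : R) ^ (t + 1) := by
    rw [← pow_add, Nat.sub_add_cancel hst]
  have key : (2 : R) ^ (2 * s) • (H' - (mI / 2 ^ t) • (1 : Matrix n n R))
      = (2 : R) ^ (2 * s - (t + 1)) • (A2 - (2 * mI) • (1 : Matrix n n R)) := by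
    rw [← hA2, h2s, mul_smul]
    congr 1
    rw [smul_sub, smul_smul]
    congr 2
    rw [pow_succ]
    field_simp
  exact le_dotProduct_mulVec_of_cholesky_residual H' T M ((2 : R) ^ (2 * s)) (mI / 2 ^ t) τ
    (by positivity) (key.trans hfac) hrow hcol v

end Summit.Ventures.CertifiedQuantumChemistry
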